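import Mathlib
import Literature.MathematicalPhysics.QuantumFieldTheory.GaugeOSData
import Literature.MathematicalPhysics.QuantumLattice.WilsonBlockHeatBathLightCone2
import HarnessLib

/-!
# `ContinuumLegGivenGap` (stmt-QuantumFields-8782), line `Sketch` — exactness of reshape 5

Support file for the crux item stmt-QuantumFields-8782
(`Summit.QuantumFields.YangMills.Theses.ConvexGribovBody.ContinuumLegGivenGap`), continuation lead c2.

The line docks the crux on the hub stmt-8762, whose hypothesis (1) wants, at each `(G, r)`, β-FREE
per-pair clustering constants `C(A, B)` with a rate function `m(β) > 0` and a threshold function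
`S₀(β)` (the "uniform shape"). Reshape 5 of the line replaces the β-regularity core of reshape 4 by a
SEPARABLE-DOMINATION condition: a β-independent template `b(A, B)` and per-β multipliers `ν(β)` with
every pair bounded by `‖A‖∞ ‖B‖∞ · exp(ν(β) b(A, B)) · e^{−μ(β) n}` on all tori, `n ≤ S`
(the "dominated shape"). The registered stub `stub_dominationCompose` is dominated ⇒ uniform (rate
sacrifice). THIS file proves the converse, `dominated_of_uniformShape`: uniform ⇒ dominated, with the
template `b(A, B) := 1 + log (max 1 (C(A,B) / (‖A‖∞ ‖B‖∞)))` and `ν(β) := max 1 (log 2 + m(β) S₀(β))`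
(the finitely many sub-threshold tori at each `β` are absorbed by the a priori bound
`|corr| ≤ 2 ‖A‖∞ ‖B‖∞`). Hence the dominated shape is the EXACT residual of the adapter: nothing is
lost by the reshape, and the two structural sources of a template — geometry at each coupling
(`SupportGrowth`, reshape 5) or diagonalisation over a countable β-cover (`UniformOnCompacts`,
reshape 4) — are both sufficient.

Tree objects only; no definitions, no facts.
-/

noncomputable section

namespace Summit.QuantumFields.YangMills.Theorems.ContinuumLegGivenGap

open Literature.MathematicalPhysics.QuantumFieldTheory
open Literature.MathematicalPhysics.QuantumLattice (LGConfig torusLift configShift)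
open Literature.MathematicalPhysics.QuantumLattice.WilsonBlockHeatBath
  (abs_latticeConnectedCorr_le_two_mul)

variable {G : Type} [Group G] [TopologicalSpace G] [IsTopologicalGroup G] [CompactSpace G]
  [MeasurableSpace G] [BorelSpace G]

omit [TopologicalSpace G] [IsTopologicalGroup G] [CompactSpace G] [BorelSpace G] in
/-- The sup norm `⨆ U, |A.F U|` of a local gauge-invariant observable bounds it pointwise (the
observable is bounded, so the supremum is a genuine one; private copy of the worker's
`abs_apply_le_iSup` in `…StubDominationCompose.lean`). [folklore] -/
private theorem abs_le_supNorm (A : YMSpecies G) (U : LGConfig 4 G) : |A.F U| ≤ ⨆ V, |A.F V| := by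
  have hbdd : BddAbove (Set.range fun V => |A.F V|) := by
    obtain ⟨C, hC⟩ := A.bounded
    exact ⟨C, by rintro _ ⟨V, rfl⟩; exact hC V⟩
  exact le_ciSup hbdd U

/-- A connected torus correlation with an identically vanishing left observable vanishes. [folklore] -/
theorem latticeConnectedCorr_eq_zero_of_left {N : ℕ} (ρ : G →* Matrix (Fin N) (Fin N) ℂ) (β : ℝ)
    (S : ℕ) [NeZero S] {A : LGConfig 4 G → ℝ} (hA : ∀ U, A U = 0) (B : LGConfig 4 G → ℝ) (n : ℕ) :
    latticeConnectedCorr ρ β S A B n = 0 := by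
  obtain rfl : A = fun _ => 0 := funext hA
  simp [latticeConnectedCorr]

/-- A connected torus correlation with an identically vanishing right observable vanishes. [folklore] -/
theorem latticeConnectedCorr_eq_zero_of_right {N : ℕ} (ρ : G →* Matrix (Fin N) (Fin N) ℂ) (β : ℝ)
    (S : ℕ) [NeZero S] (A : LGConfig 4 G → ℝ) {B : LGConfig 4 G → ℝ} (hB : ∀ U, B U = 0) (n : ℕ) :
    latticeConnectedCorr ρ β S A B n = 0 := by
  obtain rfl : B = fun _ => 0 := funext hB
  simp [latticeConnectedCorr]

/-- **Uniform shape ⇒ dominated shape** (exactness of reshape 5 of line `Sketch`, per `(G, r)`):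
β-free pair constants `C(A, B)` at rates `m(β) > 0` above `β₁`, with volume thresholds `S₀(β)`, give
a separably dominated family with the β-INDEPENDENT template
`b(A, B) := 1 + log (max 1 (C(A,B) / (‖A‖∞ ‖B‖∞)))` and the multiplier
`ν(β) := max 1 (log 2 + m(β) S₀(β))`, at the same rate, WITHOUT thresholds: above the threshold
`C ≤ ‖A‖∞‖B‖∞ e^{b} ≤ ‖A‖∞‖B‖∞ e^{ν b}`, below it the a priori bound `2‖A‖∞‖B‖∞ ≤ ‖A‖∞‖B‖∞ e^{ν} e^{−m n}`
(`n ≤ S < S₀(β)`), and a pair with `‖A‖∞ ‖B‖∞ = 0` has vanishing correlations. Together with the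
registered stub `stub_dominationCompose` (dominated ⇒ uniform, rate sacrifice) this shows that the
dominated shape is EQUIVALENT to hypothesis (1) of stmt-8762 at `(G, r)`. [folklore] -/
theorem dominated_of_uniformShape :
    ∀ (G : Type) [Group G] [TopologicalSpace G] [IsTopologicalGroup G] [CompactSpace G]
      [MeasurableSpace G] [BorelSpace G] (r : LatticeRep G) (β₁ : ℝ) (m : ℝ → ℝ) (S₀ : ℝ → ℕ),
      (∀ β : ℝ, β₁ ≤ β → 0 < m β) →
      (∀ A B : YMSpecies G, ∃ C : ℝ, ∀ β : ℝ, β₁ ≤ β → ∀ S n : ℕ, S₀ β ≤ S → n ≤ S →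
        |latticeConnectedCorr r.ρ β (2 * S + 1) A.F B.F n| ≤ C * Real.exp (-(m β * n))) →
      ∃ b : YMSpecies G → YMSpecies G → ℝ, ∀ β : ℝ, β₁ ≤ β → ∃ μ : ℝ, 0 < μ ∧ ∃ ν : ℝ,
        ∀ A B : YMSpecies G, ∀ S n : ℕ, n ≤ S →
          |latticeConnectedCorr r.ρ β (2 * S + 1) A.F B.F n| ≤
            (⨆ U, |A.F U|) * (⨆ U, |B.F U|) * Real.exp (ν * b A B) * Real.exp (-(μ * n)) := by
  intro G _ _ _ _ _ _ r β₁ m S₀ hm hC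
  choose C hC using hC
  -- the template: one plus the log-excess of the pair constant over the product of sup norms
  refine ⟨fun A B => 1 + Real.log (max 1 (C A B / ((⨆ U, |A.F U|) * ⨆ U, |B.F U|))),
    fun β hβ => ⟨m β, hm β hβ, max 1 (Real.log 2 + m β * S₀ β), fun A B S n hn => ?_⟩⟩
  set a : ℝ := ⨆ U, |A.F U| with ha
  set a' : ℝ := ⨆ U, |B.F U| with ha'
  set ν : ℝ := max 1 (Real.log 2 + m β * S₀ β) with hν
  set b : ℝ := 1 + Real.log (max 1 (C A B / (a * a'))) with hb
  have hmβ : 0 < m β := hm β hβ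
  have hAle : ∀ U, |A.F U| ≤ a := fun U => abs_le_supNorm A U
  have hBle : ∀ U, |B.F U| ≤ a' := fun U => abs_le_supNorm B U
  have ha0 : 0 ≤ a := Real.iSup_nonneg fun U => abs_nonneg _
  have ha'0 : 0 ≤ a' := Real.iSup_nonneg fun U => abs_nonneg _
  have hP0 : 0 ≤ a * a' := mul_nonneg ha0 ha'0
  have hν1 : 1 ≤ ν := le_max_left _ _
  have hb1 : 1 ≤ b := by
    have : 0 ≤ Real.log (max 1 (C A B / (a * a'))) := Real.log_nonneg (le_max_left _ _)
    simp only [hb]; linarith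
  have hb0 : 0 ≤ b := le_trans zero_le_one hb1
  have hexp0 : 0 < Real.exp (-(m β * n)) := Real.exp_pos _
  rcases eq_or_lt_of_le hP0 with hP | hP
  · -- degenerate pair: one sup norm vanishes, so the correlation vanishes
    have hcorr : latticeConnectedCorr r.ρ β (2 * S + 1) A.F B.F n = 0 := by
      rcases mul_eq_zero.1 hP.symm with h0 | h0
      · refine latticeConnectedCorr_eq_zero_of_left r.ρ β (2 * S + 1) (fun U => ?_) B.F n
        exact abs_nonpos_iff.1 ((hAle U).trans_eq h0)
      · refine latticeConnectedCorr_eq_zero_of_right r.ρ β (2 * S + 1) A.F (fun U => ?_) n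
        exact abs_nonpos_iff.1 ((hBle U).trans_eq h0)
    rw [hcorr, abs_zero, ← hP, zero_mul, zero_mul]
  · -- non-degenerate pair
    -- key lower bound on the dominating factor: `e^{ν b} ≥ e^{b}` and `e^{ν b} ≥ e^{ν}`
    have hνb_b : b ≤ ν * b := by nlinarith
    have hνb_ν : ν ≤ ν * b := by nlinarith
    by_cases hS : S₀ β ≤ S
    · -- above the threshold: the β-free constant is dominated by `a a' e^{b}`
      have h1 : |latticeConnectedCorr r.ρ β (2 * S + 1) A.F B.F n| ≤ C A B * Real.exp (-(m β * n)) :=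
        hC A B β hβ S n hS hn
      have h2 : C A B ≤ a * a' * Real.exp (ν * b) := by
        have h3 : C A B / (a * a') ≤ max 1 (C A B / (a * a')) := le_max_right _ _
        have h4 : max 1 (C A B / (a * a')) = Real.exp (Real.log (max 1 (C A B / (a * a')))) :=
          (Real.exp_log (lt_of_lt_of_le one_pos (le_max_left _ _))).symm
        have h5 : Real.log (max 1 (C A B / (a * a'))) ≤ ν * b := by
          have : Real.log (max 1 (C A B / (a * a'))) ≤ b := by simp only [hb]; linarith
          exact this.trans hνb_b
        have h6 : C A B / (a * a') ≤ Real.exp (ν * b) := by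
          rw [h4] at h3; exact h3.trans (Real.exp_le_exp.2 h5)
        rwa [div_le_iff₀ hP, mul_comm] at h6
      calc |latticeConnectedCorr r.ρ β (2 * S + 1) A.F B.F n|
          ≤ C A B * Real.exp (-(m β * n)) := h1
        _ ≤ a * a' * Real.exp (ν * b) * Real.exp (-(m β * n)) :=
            mul_le_mul_of_nonneg_right h2 hexp0.le
    · -- below the threshold: a priori bound, `2 e^{m n} ≤ 2 e^{m S₀} ≤ e^{ν}`
      push Not at hS
      have h1 : |latticeConnectedCorr r.ρ β (2 * S + 1) A.F B.F n| ≤ 2 * (a * a') :=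
        abs_latticeConnectedCorr_le_two_mul r β (2 * S + 1) hAle hBle n
      have hnS : (n : ℝ) ≤ S₀ β := by exact_mod_cast (hn.trans hS.le)
      have h2 : Real.log 2 + m β * n ≤ ν * b := by
        have : Real.log 2 + m β * n ≤ Real.log 2 + m β * S₀ β := by nlinarith
        exact (this.trans (le_max_right _ _)).trans hνb_ν
      have h3 : (2 : ℝ) ≤ Real.exp (ν * b) * Real.exp (-(m β * n)) := by
        rw [← Real.exp_add]
        have : Real.log 2 ≤ ν * b + -(m β * n) := by linarith
        calc (2 : ℝ) = Real.exp (Real.log 2) := (Real.exp_log two_pos).symm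
          _ ≤ Real.exp (ν * b + -(m β * n)) := Real.exp_le_exp.2 this
      calc |latticeConnectedCorr r.ρ β (2 * S + 1) A.F B.F n| ≤ 2 * (a * a') := h1
        _ = a * a' * 2 := by ring
        _ ≤ a * a' * (Real.exp (ν * b) * Real.exp (-(m β * n))) :=
            mul_le_mul_of_nonneg_left h3 hP.le
        _ = a * a' * Real.exp (ν * b) * Real.exp (-(m β * n)) := by ring

end Summit.QuantumFields.YangMills.Theorems.ContinuumLegGivenGap

end
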